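import Literature.Computability.QuantumComplexity.StabilizerSimulation
import Literature.Computability.QuantumComplexity.CircuitEmbedding
import Literature.Computability.QuantumComplexity.ControlledHadamard
import HarnessLib

/-!
# Stabilizer-rank simulation — discharged facts

Proofs of named facts stated in `Literature.Computability.QuantumComplexity.StabilizerSimulation`
(kept in a sibling file so that the statement file stays a definitions/named-facts file and
keeps its light imports):

* `BravyiSmithSmolin2016_stabilizerRank_tensorVec_le_holds` discharges
  `BravyiSmithSmolin2016_stabilizerRank_tensorVec_le`: **sub-multiplicativity of the stabilizer
  rank**, `χ(ψ ⊗ φ) ≤ χ(ψ) · χ(φ)` (Bravyi–Smith–Smolin 2016, §I: "`χ_{n+m} ≤ χ_n χ_m` since a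
  tensor product of two stabilizer states is a stabilizer state"; §IV eq. (9): the tensor power
  of a stabilizer decomposition is a stabilizer decomposition).

## Proof architecture (all proved here, over the tree's operational definitions)

* `placeGate_mem_cliffordCircuits`: transporting a Clifford circuit along a wire embedding
  `f : Fin n ↪ Fin m` (`placeGate f`, i.e. `C ↦ C ⊗ 1` up to wire reindexing) gives a Clifford
  circuit (`placeGate_placeGate`, `placeGate_mul_holds`, closure induction);
* `placeGate_castAddEmb_mulVec_tensorVec` / `placeGate_natAddEmb_mulVec_tensorVec`: an operator
  placed on the first `a` (last `b`) wires acts on the first (second) tensor factor,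
  `(C ⊗ 1)(ψ ⊗ φ) = Cψ ⊗ φ`, `(1 ⊗ D)(ψ ⊗ φ) = ψ ⊗ Dφ` (Nielsen–Chuang §2.1.7, eq. (2.45));
* `tensorVec_mem_stabilizerStates`: hence `C|0^a⟩ ⊗ D|0^b⟩ = (C ⊗ 1)(1 ⊗ D)|0^{a+b}⟩` is a
  stabilizer state — the one-line argument printed in the source;
* `basisState_mem_stabilizerStates`: computational basis states are stabilizer states
  (`|w⟩ = ∏_{i : w_i = 1} X_i |0ⁿ⟩` with `X = H S S H`, `xWord_mulVec_basisState` of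
  `ReversibleCliffordT.lean`), so every vector has a stabilizer decomposition
  (`stabilizerRank_le_card`, `exists_stabilizerDecomposition`: the `sInf` defining `χ` is
  attained) — this is the source's remark "`1 ≤ χ(ψ) ≤ 2ⁿ`" (§I) minus positivity;
* bilinearity of `tensorVec` (`tensorVec_sum_smul`) and reindexing `Fin r × Fin s` finish.

Tree reuse: `placeGate_mulVec_apply` (`CircuitEmbedding.lean`), `placeGate_placeGate`,
`extend_apply_of_not_mem` (`ForrelationThm25Amplitude.lean`), `placeGate_mul_holds`
(`QubitRegisterProofs.lean`), `xWord_mulVec_basisState` (`ReversibleCliffordT.lean`),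
`eq_sum_smul_basisState` (`ControlledHadamard.lean`); Mathlib: `Submonoid.closure_induction`,
`Nat.sInf_mem`, `Equiv.sum_comp`, `Fintype.sum_prod_type`, `Fin.castAddEmb`/`Fin.natAddEmb`.

## References

* S. Bravyi, G. Smith, J. A. Smolin, *Trading classical and quantum computational resources*,
  Phys. Rev. X 6 (2016) 021043, arXiv:1506.01396: §I (definition of `χ`, "`1 ≤ χ(ψ) ≤ 2ⁿ`",
  "`χ_{n+m} ≤ χ_n χ_m` since a tensor product of two stabilizer states is a stabilizer state"),
  §IV eqs. (8)–(9) (tensor powers of stabilizer decompositions).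
* M. A. Nielsen, I. L. Chuang, *Quantum Computation and Quantum Information*, CUP 2010, §2.1.7
  eq. (2.45) (`(A ⊗ B)(v ⊗ w) = Av ⊗ Bw`), §4.2 Ex. 4.18 (`HZH = X`), §10.5.1 (stabilizer
  formalism: computational basis states are stabilizer states).
-/

noncomputable section

namespace Literature.Computability.QuantumComplexity

open _root_.Computability Cryptography Matrix

/-! ### Tensor products of state vectors: evaluation, bilinearity, the vacuum -/

section tensor

variable {a b : ℕ}

/-- Definitional unfolding of the tree's `tensorVec`:
`(ψ ⊗ φ)(z) = ψ(z|_{first a}) φ(z|_{last b})`. [folklore] -/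
theorem tensorVec_apply (ψ : QReg a → ℂ) (φ : QReg b → ℂ) (z : QReg (a + b)) :
    tensorVec ψ φ z = ψ (fun i => z (Fin.castAdd b i)) * φ (fun j => z (Fin.natAdd a j)) := rfl

/-- **Bilinearity of the tensor product** on finite linear combinations:
`(∑ cᵢ ψᵢ) ⊗ (∑ dⱼ φⱼ) = ∑ᵢ ∑ⱼ cᵢ dⱼ (ψᵢ ⊗ φⱼ)`. [Nielsen–Chuang 2010, §2.1.7] [folklore] -/
theorem tensorVec_sum_smul {r s : ℕ} (c : Fin r → ℂ) (ψ : Fin r → QReg a → ℂ) (d : Fin s → ℂ)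
    (φ : Fin s → QReg b → ℂ) :
    tensorVec (∑ i, c i • ψ i) (∑ j, d j • φ j) = ∑ i, ∑ j, (c i * d j) • tensorVec (ψ i) (φ j) := by
  funext z
  simp only [tensorVec_apply, Finset.sum_apply, Pi.smul_apply, smul_eq_mul]
  rw [Finset.sum_mul_sum]
  refine Finset.sum_congr rfl fun i _ => Finset.sum_congr rfl fun j _ => ?_
  ring

/-- `|0^a⟩ ⊗ |0^b⟩ = |0^{a+b}⟩`. [Nielsen–Chuang 2010, §2.1.7] [folklore] -/
theorem tensorVec_zeroState (a b : ℕ) : tensorVec (zeroState a) (zeroState b) = zeroState (a + b) := by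
  funext z
  by_cases hz : z = fun _ => false
  · subst hz
    simp [tensorVec_apply, zeroState]
  · have hne : ¬ ((fun i => z (Fin.castAdd b i)) = (fun _ => false) ∧
        (fun j => z (Fin.natAdd a j)) = fun _ => false) := by
      rintro ⟨h1, h2⟩
      refine hz (funext fun k => Fin.addCases (fun i => ?_) (fun j => ?_) k)
      · exact congrFun h1 i
      · exact congrFun h2 j
    simp only [tensorVec_apply, zeroState, basisState_apply, if_neg hz, mul_ite, mul_one, mul_zero]
    split_ifs with h1 h2
    · exact absurd ⟨h2, h1⟩ hne
    · rfl
    · rfl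

/-- The last `b` wires are not among the first `a` wires. [folklore] -/
theorem natAdd_not_mem_range_castAddEmb (j : Fin b) : Fin.natAdd a j ∉ Set.range (Fin.castAddEmb b) := by
  rintro ⟨i, hi⟩
  rw [Fin.castAddEmb_apply, Fin.ext_iff, Fin.val_castAdd, Fin.val_natAdd] at hi
  omega

/-- The first `a` wires are not among the last `b` wires. [folklore] -/
theorem castAdd_not_mem_range_natAddEmb (i : Fin a) : Fin.castAdd b i ∉ Set.range (Fin.natAddEmb a) := by
  rintro ⟨j, hj⟩
  rw [Fin.natAddEmb_apply, Fin.ext_iff, Fin.val_castAdd, Fin.val_natAdd] at hj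
  omega

/-- **An operator placed on the first factor acts on the first factor**:
`(C ⊗ 1)(ψ ⊗ φ) = (Cψ) ⊗ φ`. [Nielsen–Chuang 2010, §2.1.7 eq. (2.45)]
[cite: NielsenChuang2010, §2.1.7 eq. (2.45)] -/
theorem placeGate_castAddEmb_mulVec_tensorVec (C : Matrix (QReg a) (QReg a) ℂ) (ψ : QReg a → ℂ)
    (φ : QReg b → ℂ) : placeGate (Fin.castAddEmb b) C *ᵥ tensorVec ψ φ = tensorVec (C *ᵥ ψ) φ := by
  funext x
  rw [placeGate_mulVec_apply]
  have hA : ∀ z : QReg a, (fun i => Function.extend (Fin.castAddEmb b) z x (Fin.castAdd b i)) = z :=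
    fun z => funext fun i => (Fin.castAddEmb b).injective.extend_apply _ _ i
  have hB : ∀ z : QReg a, (fun j => Function.extend (Fin.castAddEmb b) z x (Fin.natAdd a j)) =
      fun j => x (Fin.natAdd a j) :=
    fun z => funext fun j => extend_apply_of_not_mem _ _ _ (natAdd_not_mem_range_castAddEmb j)
  have hC : (x ∘ Fin.castAddEmb b) = fun i => x (Fin.castAdd b i) := rfl
  simp only [tensorVec_apply, Matrix.mulVec, dotProduct, Finset.sum_mul]
  refine Finset.sum_congr rfl fun z _ => ?_
  rw [hA z, hB z, hC, mul_assoc]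

/-- **An operator placed on the second factor acts on the second factor**:
`(1 ⊗ D)(ψ ⊗ φ) = ψ ⊗ (Dφ)`. [Nielsen–Chuang 2010, §2.1.7 eq. (2.45)]
[cite: NielsenChuang2010, §2.1.7 eq. (2.45)] -/
theorem placeGate_natAddEmb_mulVec_tensorVec (D : Matrix (QReg b) (QReg b) ℂ) (ψ : QReg a → ℂ)
    (φ : QReg b → ℂ) : placeGate (Fin.natAddEmb a) D *ᵥ tensorVec ψ φ = tensorVec ψ (D *ᵥ φ) := by
  funext x
  rw [placeGate_mulVec_apply]
  have hA : ∀ z : QReg b, (fun i => Function.extend (Fin.natAddEmb a) z x (Fin.castAdd b i)) =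
      fun i => x (Fin.castAdd b i) :=
    fun z => funext fun i => extend_apply_of_not_mem _ _ _ (castAdd_not_mem_range_natAddEmb i)
  have hB : ∀ z : QReg b, (fun j => Function.extend (Fin.natAddEmb a) z x (Fin.natAdd a j)) = z :=
    fun z => funext fun j => (Fin.natAddEmb a).injective.extend_apply _ _ j
  have hC : (x ∘ Fin.natAddEmb a) = fun j => x (Fin.natAdd a j) := rfl
  simp only [tensorVec_apply, Matrix.mulVec, dotProduct, Finset.mul_sum]
  refine Finset.sum_congr rfl fun z _ => ?_
  rw [hA z, hB z, hC]
  ring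

end tensor

/-! ### Clifford circuits under wire embeddings; tensor products of stabilizer states -/

/-- **Transport of Clifford circuits along a wire embedding.** If `C` is a Clifford circuit on
`n` wires and `f : Fin n ↪ Fin m`, then `placeGate f C` (`C` on the wires `f`, identity
elsewhere) is a Clifford circuit on `m` wires: generators go to generators
(`placeGate f (placeGate e U) = placeGate (e.trans f) U`) and `placeGate f` is multiplicative.
[Aaronson–Gottesman 2004, §I; Nielsen–Chuang 2010, §4.2] [folklore] -/
theorem placeGate_mem_cliffordCircuits {n m : ℕ} (f : Fin n ↪ Fin m)
    {C : Matrix (QReg n) (QReg n) ℂ} (hC : C ∈ cliffordCircuits n) :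
    placeGate f C ∈ cliffordCircuits m := by
  unfold cliffordCircuits at hC ⊢
  induction hC using Submonoid.closure_induction with
  | mem M hM =>
    obtain ⟨g, e, rfl⟩ := hM
    rw [placeGate_placeGate]
    exact Submonoid.subset_closure ⟨g, e.trans f, rfl⟩
  | one =>
    rw [placeGate_one]
    exact Submonoid.one_mem _
  | mul M M' _ _ ihM ihM' =>
    rw [placeGate_mul_holds]
    exact Submonoid.mul_mem _ ihM ihM'

/-- **A tensor product of two stabilizer states is a stabilizer state**:
`C|0^a⟩ ⊗ D|0^b⟩ = (C ⊗ 1)(1 ⊗ D)(|0^a⟩ ⊗ |0^b⟩)` with `(C ⊗ 1)(1 ⊗ D)` a Clifford circuit on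
`a + b` wires and `|0^a⟩ ⊗ |0^b⟩ = |0^{a+b}⟩`. This is the argument printed in
Bravyi–Smith–Smolin 2016, §I ("since a tensor product of two stabilizer states is a stabilizer
state"). [cite: BravyiSmithSmolin2016, §I] -/
theorem tensorVec_mem_stabilizerStates {a b : ℕ} {ψ : QReg a → ℂ} {φ : QReg b → ℂ}
    (hψ : ψ ∈ stabilizerStates a) (hφ : φ ∈ stabilizerStates b) :
    tensorVec ψ φ ∈ stabilizerStates (a + b) := by
  obtain ⟨C, hC, rfl⟩ := hψ
  obtain ⟨D, hD, rfl⟩ := hφ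
  refine ⟨placeGate (Fin.castAddEmb b) C * placeGate (Fin.natAddEmb a) D,
    Submonoid.mul_mem _ (placeGate_mem_cliffordCircuits _ hC) (placeGate_mem_cliffordCircuits _ hD), ?_⟩
  rw [← Matrix.mulVec_mulVec, ← tensorVec_zeroState, placeGate_natAddEmb_mulVec_tensorVec,
    placeGate_castAddEmb_mulVec_tensorVec]

/-! ### Basis states are stabilizer states; every vector has a stabilizer decomposition -/

/-- The word `H S S H` (`= X`) on wire `i` is a Clifford circuit. [Nielsen–Chuang 2010, §4.2
Ex. 4.18] [folklore] -/
theorem xWord_toMatrix_mem_cliffordCircuits {N : ℕ} (A : Language Bool) (i : Fin N) :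
    (⟨xWord i⟩ : QCircuit cliffordT N).toMatrix A ∈ cliffordCircuits N := by
  have hH : (hOn i).toMatrix A ∈ cliffordCircuits N :=
    Submonoid.subset_closure ⟨CliffordOp.H, wireEmb i, rfl⟩
  have hS : (sOn i).toMatrix A ∈ cliffordCircuits N :=
    Submonoid.subset_closure ⟨CliffordOp.S, wireEmb i, rfl⟩
  simp only [xWord, QCircuit.toMatrix_cons, QCircuit.toMatrix_nil, one_mul]
  exact Submonoid.mul_mem _ (Submonoid.mul_mem _ (Submonoid.mul_mem _ hH hS) hS) hH

/-- **Computational basis states are stabilizer states**: `|w⟩ = ∏_{i : w i = 1} X_i |0ⁿ⟩`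
with `X = H S S H` Clifford (induction on the support of `w`). [Nielsen–Chuang 2010, §10.5.1;
Aaronson–Gottesman 2004, §I] [folklore] -/
theorem basisState_mem_stabilizerStates {N : ℕ} (w : QReg N) : basisState w ∈ stabilizerStates N := by
  suffices h : ∀ (s : Finset (Fin N)) (w : QReg N), (∀ i, w i = true → i ∈ s) →
      basisState w ∈ stabilizerStates N from
    h Finset.univ w fun i _ => Finset.mem_univ i
  intro s
  refine Finset.induction_on s ?_ ?_
  · intro w hw
    have : w = fun _ => false := funext fun i => by
      cases h : w i
      · rfl
      · exact absurd (hw i h) (Finset.notMem_empty i)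
    subst this
    exact zeroState_mem_stabilizerStates N
  · intro i s hi ih w hw
    have hw' : basisState (Function.update w i false) ∈ stabilizerStates N := by
      refine ih _ fun j hj => ?_
      by_cases hji : j = i
      · subst hji
        simp at hj
      · rw [Function.update_of_ne hji] at hj
        exact (Finset.mem_insert.1 (hw j hj)).resolve_left hji
    cases hwi : w i
    · have : Function.update w i false = w := by rw [← hwi, Function.update_eq_self]
      rwa [this] at hw'
    · have key := xWord_mulVec_basisState (0 : Language Bool) i (Function.update w i false)
      simp only [Function.update_self, Function.update_idem, Bool.not_false] at key
      have hw1 : Function.update w i true = w := by rw [← hwi, Function.update_eq_self]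
      rw [hw1] at key
      rw [← key]
      exact mulVec_mem_stabilizerStates (xWord_toMatrix_mem_cliffordCircuits 0 i) hw'

/-- **A stabilizer decomposition over any finite index type bounds the rank by its size**:
if `ψ = ∑_{i ∈ ι} cᵢ φᵢ` with stabilizer states `φᵢ`, then `χ(ψ) ≤ |ι|` (reindex along
`ι ≃ Fin |ι|`). [Bravyi–Smith–Smolin 2016, §I (definition of `χ`)] [folklore] -/
theorem stabilizerRank_le_card {N : ℕ} {ι : Type*} [Fintype ι] {ψ : QReg N → ℂ} (c : ι → ℂ)
    (φ : ι → QReg N → ℂ) (hφ : ∀ i, φ i ∈ stabilizerStates N) (h : ψ = ∑ i, c i • φ i) :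
    stabilizerRank ψ ≤ Fintype.card ι := by
  refine Nat.sInf_le ⟨fun k => c ((Fintype.equivFin ι).symm k),
    fun k => φ ((Fintype.equivFin ι).symm k), fun k => hφ _, ?_⟩
  rw [h]
  exact ((Fintype.equivFin ι).symm.sum_comp (fun i => c i • φ i)).symm

/-- `χ(ψ) ≤ 2ⁿ` for every `n`-qubit vector `ψ` (decomposition into basis states).
[Bravyi–Smith–Smolin 2016, §I: "`1 ≤ χ(ψ) ≤ 2ⁿ` for any `n`-qubit state `ψ`"]
[cite: BravyiSmithSmolin2016, §I] -/
theorem stabilizerRank_le_two_pow {N : ℕ} (ψ : QReg N → ℂ) : stabilizerRank ψ ≤ 2 ^ N := by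
  have h := stabilizerRank_le_card (fun x => ψ x) (fun x => basisState x)
    (fun x => basisState_mem_stabilizerStates x) (eq_sum_smul_basisState ψ)
  simpa [QReg, Fintype.card_fun, Fintype.card_bool, Fintype.card_fin] using h

/-- **The rank is attained**: every vector `ψ` has a stabilizer decomposition with exactly
`χ(ψ)` terms (the set of admissible term counts is nonempty — it contains `2ⁿ` — and `χ` is
its least element). [Bravyi–Smith–Smolin 2016, §I] [folklore] -/
theorem exists_stabilizerDecomposition {N : ℕ} (ψ : QReg N → ℂ) :
    ∃ (c : Fin (stabilizerRank ψ) → ℂ) (φ : Fin (stabilizerRank ψ) → QReg N → ℂ),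
      (∀ i, φ i ∈ stabilizerStates N) ∧ ψ = ∑ i, c i • φ i := by
  classical
  have hne : {r | ∃ (c : Fin r → ℂ) (φ : Fin r → QReg N → ℂ),
      (∀ i, φ i ∈ stabilizerStates N) ∧ ψ = ∑ i, c i • φ i}.Nonempty :=
    ⟨Fintype.card (QReg N), fun k => ψ ((Fintype.equivFin (QReg N)).symm k),
      fun k => basisState ((Fintype.equivFin (QReg N)).symm k),
      fun k => basisState_mem_stabilizerStates _, by
        conv_lhs => rw [eq_sum_smul_basisState ψ]
        exact ((Fintype.equivFin (QReg N)).symm.sum_comp (fun x => ψ x • basisState x)).symm⟩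
  exact Nat.sInf_mem hne

/-! ### Sub-multiplicativity of the stabilizer rank -/

/-- **Discharge of `BravyiSmithSmolin2016_stabilizerRank_tensorVec_le`** — sub-multiplicativity
of the stabilizer rank, `χ(ψ ⊗ φ) ≤ χ(ψ) χ(φ)`: take decompositions of `ψ` and `φ` with `χ(ψ)`
and `χ(φ)` stabilizer terms (`exists_stabilizerDecomposition`); by bilinearity their tensor
product is a combination of the `χ(ψ) χ(φ)` states `ψᵢ ⊗ φⱼ`, each a stabilizer state
(`tensorVec_mem_stabilizerStates`). Printed for the magic-state powers as "`χ_{n+m} ≤ χ_n χ_m`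
since a tensor product of two stabilizer states is a stabilizer state" (§I) and used as the
tensor-power decomposition eq. (9) of §IV; the argument is verbatim the general one.
[cite: BravyiSmithSmolin2016, §I and §IV eq. (9)] -/
theorem BravyiSmithSmolin2016_stabilizerRank_tensorVec_le_holds :
    BravyiSmithSmolin2016_stabilizerRank_tensorVec_le := by
  intro a b ψ φ
  obtain ⟨c, ψs, hψs, hψ⟩ := exists_stabilizerDecomposition ψ
  obtain ⟨d, φs, hφs, hφ⟩ := exists_stabilizerDecomposition φ
  have key : tensorVec ψ φ =
      ∑ p : Fin (stabilizerRank ψ) × Fin (stabilizerRank φ), (c p.1 * d p.2) • tensorVec (ψs p.1) (φs p.2) := by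
    have e1 : tensorVec ψ φ = tensorVec (∑ i, c i • ψs i) (∑ j, d j • φs j) := by rw [← hψ, ← hφ]
    rw [e1, tensorVec_sum_smul, Fintype.sum_prod_type]
  calc stabilizerRank (tensorVec ψ φ)
      ≤ Fintype.card (Fin (stabilizerRank ψ) × Fin (stabilizerRank φ)) :=
        stabilizerRank_le_card _ _ (fun p => tensorVec_mem_stabilizerStates (hψs p.1) (hφs p.2)) key
    _ = stabilizerRank ψ * stabilizerRank φ := by simp

/-! ### Corollaries -/

/-- Sub-multiplicativity along tensor powers, unconditionally:
`χ(ψ^{⊗(m+1)}) ≤ χ(ψ^{⊗m}) χ(ψ)`. [cite: BravyiSmithSmolin2016, §I] -/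
theorem stabilizerRank_tensorPow_succ_le (ψ : QReg 1 → ℂ) (m : ℕ) :
    stabilizerRank (tensorPow ψ (m + 1)) ≤ stabilizerRank (tensorPow ψ m) * stabilizerRank ψ :=
  BravyiSmithSmolin2016_stabilizerRank_tensorVec_le_holds.tensorPow_succ ψ m

/-- Hence `χ(ψ^{⊗m}) ≤ χ(ψ)^m` (Bravyi–Smith–Smolin 2016, §I: "`χ_n ≤ (χ_2)^{n/2}`", here with
blocks of size one). [cite: BravyiSmithSmolin2016, §I] -/
theorem stabilizerRank_tensorPow_le_pow (ψ : QReg 1 → ℂ) (m : ℕ) :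
    stabilizerRank (tensorPow ψ m) ≤ stabilizerRank ψ ^ m := by
  induction m with
  | zero => simpa using stabilizerRank_tensorPow_zero_le ψ
  | succ m ih =>
    calc stabilizerRank (tensorPow ψ (m + 1))
        ≤ stabilizerRank (tensorPow ψ m) * stabilizerRank ψ := stabilizerRank_tensorPow_succ_le ψ m
      _ ≤ stabilizerRank ψ ^ m * stabilizerRank ψ := Nat.mul_le_mul_right _ ih
      _ = stabilizerRank ψ ^ (m + 1) := (pow_succ _ _).symm

end Literature.Computability.QuantumComplexity
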